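import Summits.BirchSwinnertonDyer.Rank1Residual.X2.HidaLimitCongruenceAlgebra
import Summits.BirchSwinnertonDyer.Rank1Residual.X11b.HalvesReceptacle
import Literature.NumberTheory.EllipticCurves.RootNumberTwistProofs
import HarnessLib

/-!
# Route `ErratumRoadFive`, crux `IMCDivAtErratumDataAll` (item stmt-BirchSwinnertonDyer-19270), stub S2
# `stub_imcDivErratum_splitAtP`: the `p`-new multiplier SEAM of [Cas20, Thm. 2.11] at SPLIT versus
# NON-SPLIT multiplicative `p` — `1 + σ` is a unit, `1 − σ` never is; (c)♭ from congruence + divisibility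

Cell `bsd-stepL` (run/shared/lean/pub/bsd-stepL/), PART 1b ACCEL seat `bsd-stepL-imc24b` (prover, row (2),
session g3); `--supports stmt-BirchSwinnertonDyer-19270 --as helper`. Companion of
`Theorems/ErratumRoadFiveIMCDivOneSidedCongruenceLe.lean` (the one-sided-(c) limit lemmas and transfer).
HONEST FRAMING: THEOREMS ONLY (pure power-series algebra); no definition, no named fact, no `sorry`;
nothing is asserted about any curve, any `L`-function or any Selmer group; the item is NOT closed; BSD
is proved for no pair; X11b stays CONSTRUCTION-SHAPED.

## Why

On Road FF the congruence input (c) is delivered by [Cas18, (4.1)] (the two-variable `L`-function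
specialises to the members' `L`-functions) at `ν_{g_m}` and at the `p`-NEW weight-2 point `ν_f`. The
identification `ν_f(L_p(𝐟)) ∼ L_f` (Cas18 Thm. 3.1's frame, `ε_p = 0`, ONE factor `(1 − a_p p^{-1}φ(𝔭̄))`)
is asserted in [Cas18, p. 11 L9–11] via «the proof of [Cas20, Thm. 2.11]», whose PRINTED multiplier is
the `p`-OLD two-factor one `(1 − a_p p^{-1}φ(𝔭̄))·(1 − φ(𝔭̄) p^{k/2−1} a_p^{-1})` (β = p^{k−1}/α; at a
`p`-new form β_p = 0 and the second factor is absent, [Castella JIMJ 17 (2018), Thm. 2.10]; cell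
LIT-DOSSIER §20.4). Read verbatim at `k = 2`, `a_p = ε = ±1`, the two readings differ by (the square
of) the SEAM `s_ε = 1 − ε^{-1}·σ = 1 − ε·σ`, where `σ ∈ R₀⟦T⟧` is the image of the group element
`rec_𝔭̄(p)|_Γ` — a power series of constant term `1`. THIS FILE: `s_{−1} = 1 + σ` is a UNIT (constant
term `2`, `p` odd) — so at NON-split `p` (stub S1) the equality-typed (c) `(L_m) + (p)^m = (L^Σ_f) + (p)^m`
is reading-independent; `s_{+1} = 1 − σ ∈ (T)` is NEVER a unit — so at SPLIT `p` (stub S2) the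
equality-typed (c) rests on the `p`-new identification, and is NOT implied by {family congruence,
`L^Σ_f ∣ ν_f(L^Σ(𝐟))`} (explicit witness), whereas the ONE-SIDED (c)♭ `(L_m) ⊆ (L^Σ_f) + (p)^m` — all
the descent uses (companion file) — IS. This is the one place on the line of record where the S1 ∕ S2
cut of crux 19270 reads an input; it is NOT an exceptional zero of the Cas18 frame (whose value at `𝟙`
is `u·((1 − a_p p^{-1})·log_ω y_K)^2 ≠ 0` for both signs), but of the `p`-old form of the family formula.

## Contents (namespace `…X11b.PNewSeam`)

`isUnit_one_add_of_constantCoeff_eq_one`, `one_sub_mem_span_X_of_constantCoeff_eq_one`,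
`not_isUnit_one_sub_of_constantCoeff_eq_one`, **`isUnit_one_sub_C_mul_iff`** (the sign dichotomy
`IsUnit (1 − ε·σ) ↔ ε = −1` for `ε = ±1`, any commutative `A` with `2 ∈ Aˣ`),
`span_singleton_le_sup_of_sub_mem_of_dvd` ((c)♭ from congruence + divisibility),
`span_X_sq_sup_span_C_ne_top`, **`exists_seam_congruence_eq_false`** (the equality-(c) is not implied),
`isUnit_two_unrIntegers` (from the tree's `WeierstrassCurve.isUnit_two_padicInt`), **`isUnit_seam_unrSeries_iff`** (the dichotomy in
Road FF's receptacle `R₀⟦T⟧`, `p` odd).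

References: [Castella2020JIMJ] JIMJ 19, Def. 2.10, Thm. 2.11; [Castella2018] Thm. 3.1, (4.1), p. 11 L9–11;
[Castella2018Exceptional] JIMJ 17, Thm. 2.10; [Castella2018Erratum] (c) (p. 4); cell LIT-DOSSIER §20.4.
-/

set_option autoImplicit false

noncomputable section

open PowerSeries Literature.NumberTheory.EllipticCurves
open Summit.BirchSwinnertonDyer.Rank1Residual.X2 Summit.BirchSwinnertonDyer.Rank1Residual.X11b.Halves

namespace Summit.BirchSwinnertonDyer.Rank1Residual.X11b

universe u v

/-! ### The `p`-new seam: `1 + σ` is a unit, `1 − σ` never is; (c)♭ from congruence + divisibility -/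

namespace PNewSeam

section Seam

variable {A : Type u} [CommRing A]

/-- **`a_p = −1`: the seam `1 + σ` is a unit** whenever `σ` has constant term `1` (the image in
`A⟦T⟧` of a group element of `Γ`) and `2` is a unit of `A` (`p` odd). [folklore] -/
theorem isUnit_one_add_of_constantCoeff_eq_one (h2 : IsUnit (2 : A)) {σ : A⟦X⟧}
    (hσ : constantCoeff σ = 1) : IsUnit (1 + σ) := by
  rw [PowerSeries.isUnit_iff_constantCoeff, map_add, map_one, hσ]
  convert h2 using 1
  norm_num

/-- **`a_p = +1`: the seam `1 − σ` lies in `(T)`** when `σ` has constant term `1`. [folklore] -/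
theorem one_sub_mem_span_X_of_constantCoeff_eq_one {σ : A⟦X⟧} (hσ : constantCoeff σ = 1) :
    1 - σ ∈ Ideal.span {(X : A⟦X⟧)} := by
  rw [Ideal.mem_span_singleton]
  exact (PowerSeries.X_dvd_iff).mpr (by rw [map_sub, map_one, hσ, sub_self])

/-- **`a_p = +1`: the seam `1 − σ` is never a unit** (`A` nontrivial). [folklore] -/
theorem not_isUnit_one_sub_of_constantCoeff_eq_one [Nontrivial A] {σ : A⟦X⟧}
    (hσ : constantCoeff σ = 1) : ¬ IsUnit (1 - σ) := by
  rw [PowerSeries.isUnit_iff_constantCoeff, map_sub, map_one, hσ, sub_self]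
  exact not_isUnit_zero

/-- **THE SIGN DICHOTOMY.** For `ε = a_p ∈ {+1, −1}` (so `ε⁻¹ = ε`) and `σ` of constant term `1` in
`A⟦T⟧` with `2 ∈ Aˣ`, `A` nontrivial: the seam `1 − ε·σ` between the `p`-old and the `p`-new readings
of the multiplier of [Cas20, Thm. 2.11] at the `p`-new weight-2 point is a unit IFF `a_p = −1`.
[cite: Castella2020JIMJ, Thm. 2.11 (the printed multiplier `(1 − a_p p^{-1}φ(𝔭̄))(1 − φ(𝔭̄) p^{k/2−1} a_p^{-1})`)]
[cite: Castella2018Exceptional, Thm. 2.10 (one factor, β_p = 0, at a `p`-new form)] -/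
theorem isUnit_one_sub_C_mul_iff [Nontrivial A] (h2 : IsUnit (2 : A)) {ε : A}
    (hε : ε = 1 ∨ ε = -1) {σ : A⟦X⟧} (hσ : constantCoeff σ = 1) :
    IsUnit (1 - C ε * σ) ↔ ε = -1 := by
  have h1 : (1 : A) ≠ -1 := by
    intro h
    have h0 : (2 : A) = 0 := by
      calc (2 : A) = 1 + 1 := by norm_num
        _ = 1 + (-1) := by rw [← h]
        _ = 0 := by ring
    exact not_isUnit_zero (h0 ▸ h2)
  rcases hε with rfl | rfl
  · rw [map_one, one_mul]
    exact ⟨fun h ↦ absurd h (not_isUnit_one_sub_of_constantCoeff_eq_one hσ), fun h ↦ absurd h h1⟩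
  · rw [map_neg, map_one, neg_one_mul, sub_neg_eq_add]
    exact ⟨fun _ ↦ rfl, fun _ ↦ isUnit_one_add_of_constantCoeff_eq_one h2 hσ⟩

/-- **(c)♭ from what print delivers in either reading**: the family congruence `L_m − L_fam ∈ J`
(`J = (p)^m`; [Cas18, (4.1)] at `ν_{g_m}` and `ν_f` with `ν_{g_m} ≡ ν_f`) and the divisibility
`L^Σ ∣ L_fam` (the frame divides the family specialisation — true whether or not the seam is a unit)
give `(L_m) ⊆ (L^Σ) + J`. [cite: Castella2018, (4.1) and p. 11 L9–11] [cite: Castella2018Erratum, (c) (p. 4)] -/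
theorem span_singleton_le_sup_of_sub_mem_of_dvd {S : Type v} [CommRing S] {Lm Lfam LS : S}
    {J : Ideal S} (hcong : Lm - Lfam ∈ J) (hdvd : LS ∣ Lfam) :
    Ideal.span {Lm} ≤ Ideal.span {LS} ⊔ J := by
  rw [Ideal.span_singleton_le_iff_mem]
  have h : Lm = Lfam + (Lm - Lfam) := by ring
  rw [h]
  exact Ideal.add_mem _ (Ideal.mem_sup_left (Ideal.mem_span_singleton.mpr hdvd))
    (Ideal.mem_sup_right hcong)

/-- `(T², a) ≠ A⟦T⟧` for a non-unit `a ∈ A` (reduce modulo `T`). [folklore] -/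
theorem span_X_sq_sup_span_C_ne_top {a : A} (ha : ¬ IsUnit a) :
    Ideal.span {(X : A⟦X⟧) ^ 2} ⊔ Ideal.span {C a} ≠ ⊤ := by
  intro h
  have h1 : (1 : A⟦X⟧) ∈ Ideal.span {(X : A⟦X⟧) ^ 2} ⊔ Ideal.span {C a} := h ▸ Submodule.mem_top
  obtain ⟨y, hy, z, hz, hyz⟩ := Submodule.mem_sup.mp h1
  rw [Ideal.mem_span_singleton] at hy hz
  obtain ⟨y', rfl⟩ := hy
  obtain ⟨z', rfl⟩ := hz
  have h2 := congrArg (constantCoeff (R := A)) hyz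
  rw [map_add, map_mul, map_mul, map_pow, PowerSeries.constantCoeff_X, zero_pow two_ne_zero,
    zero_mul, zero_add, PowerSeries.constantCoeff_C, map_one] at h2
  exact ha (IsUnit.of_mul_eq_one _ h2)

/-- **The EQUALITY-typed (c) is NOT implied by {family congruence, divisibility} when the seam is
not a unit**: with `L^Σ = 1`, `L_fam = L_m = T²` (`= s²·L^Σ`, `s = T`) and `J = (a)`, `a` a non-unit
(`a = p`), the congruence and the divisibility hold but `(L_m) + J ≠ (L^Σ) + J`. So at `a_p = +1` a
typed F3 «`(L_m) + (p)^m = (L^Σ_f) + (p)^m`» genuinely rests on the `p`-new identification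
`ν_f(L(𝐟)) ∼ L_f`, while (c)♭ does not. [cite: Castella2020JIMJ, Thm. 2.11] [cite: Castella2018, p. 11 L9–11] -/
theorem exists_seam_congruence_eq_false [Nontrivial A] {a : A} (ha : ¬ IsUnit a) :
    ∃ LS Lfam Lm : A⟦X⟧, Lm - Lfam ∈ Ideal.span {C a} ∧ LS ∣ Lfam ∧
      Ideal.span {Lm} ≤ Ideal.span {LS} ⊔ Ideal.span {C a} ∧
      Ideal.span {Lm} ⊔ Ideal.span {C a} ≠ Ideal.span {LS} ⊔ Ideal.span {C a} := by
  refine ⟨1, X ^ 2, X ^ 2, by rw [sub_self]; exact Ideal.zero_mem _, one_dvd _, ?_, ?_⟩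
  · rw [Ideal.span_singleton_one, top_sup_eq]; exact le_top
  · rw [Ideal.span_singleton_one, top_sup_eq]
    exact span_X_sq_sup_span_C_ne_top ha

end Seam

section Unr

variable {p : ℕ} [Fact p.Prime]

/-- In `R₀ = unrIntegers p` with `p` odd, `2` is a unit (image of the unit `2 ∈ ℤ_p`). [folklore] -/
theorem isUnit_two_unrIntegers (hp : p ≠ 2) : IsUnit (2 : unrIntegers p) := by
  have h := (WeierstrassCurve.isUnit_two_padicInt hp).map (toUnr p)
  rwa [map_ofNat] at h

/-- **The dichotomy in the receptacle `R₀⟦T⟧` of Road FF** (`p` odd): for `a_p = ε ∈ {±1}` and any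
`σ ∈ R₀⟦T⟧` of constant term `1`, `IsUnit (1 − ε·σ) ↔ a_p = −1`.
[cite: Castella2020JIMJ, Thm. 2.11] [cite: Castella2018Exceptional, Thm. 2.10] -/
theorem isUnit_seam_unrSeries_iff (hp : p ≠ 2) {ε : unrIntegers p} (hε : ε = 1 ∨ ε = -1)
    {σ : UnrSeries p} (hσ : constantCoeff σ = 1) : IsUnit (1 - C ε * σ) ↔ ε = -1 := by
  haveI := HidaLimitAlgebra.isDiscreteValuationRing_unrIntegers (p := p)
  exact isUnit_one_sub_C_mul_iff (isUnit_two_unrIntegers hp) hε hσ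

end Unr

end PNewSeam

end Summit.BirchSwinnertonDyer.Rank1Residual.X11b

end
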